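import Summits.RiemannHypothesis.RiemannHypothesis.Theses.RobinHighStaircase
import HarnessLib

/-!
# Route RobinHighStaircase (L21 «ROBIN · HIGH STAIRCASE», line (ix-o)) — `Assembly` (item stmt-RiemannHypothesis-22034)

`RowsH18to21 → RowsH22to25 → RowsH26to30 → RowHTop → HighStaircase` is pure logic: under the two θ-prints
the fourteen `RH(T)`-rows of `HighStaircase` are, in order, the four conjuncts of `RowsH18to21`, the four of
`RowsH22to25`, the five of `RowsH26to30`, and `RowHTop`. Typed by the route decl (route file rev 2, sha16
4a58ad7cc9e42e43; planner rh-idea-4 g0 `Proof22034.lean`). RH-FREE in the rung sense (D-0061): finite verified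
heights in hypothesis position; Robin's criterion is not invoked and RH is not proved by this; nothing here
bears on the truth of RH.
-/

-- D-0017: `Summit.RiemannHypothesis.RiemannHypothesis.…` duplicates the namespace BY DESIGN (single-problem summit).
set_option linter.dupNamespace false

namespace Summit.RiemannHypothesis.RiemannHypothesis.Theorems.RobinHighStaircase

/-- **`Assembly` (item stmt-RiemannHypothesis-22034) holds**: regroup the 4 + 4 + 5 + 1 rows into the
14-conjunct `HighStaircase`. Pure logic. -/
theorem assembly_proof :
    Summit.RiemannHypothesis.RiemannHypothesis.Theses.RobinHighStaircase.Assembly := by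
  intro h1 h2 h3 h4 hB hK
  obtain ⟨a1, a2, a3, a4⟩ := h1 hB hK
  obtain ⟨b1, b2, b3, b4⟩ := h2 hB hK
  obtain ⟨c1, c2, c3, c4, c5⟩ := h3 hB hK
  exact ⟨a1, a2, a3, a4, b1, b2, b3, b4, c1, c2, c3, c4, c5, h4 hB hK⟩

end Summit.RiemannHypothesis.RiemannHypothesis.Theorems.RobinHighStaircase
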